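import Summits.ResolutionOfSingularities.ResolutionOfSingularities.Theses.FrobeniusLadder
import Summits.ResolutionOfSingularities.ResolutionOfSingularities.Theorems.FrobeniusLadderFRationalResolutionStubClauseOfRingEquiv
import Summits.ResolutionOfSingularities.ResolutionOfSingularities.Theorems.FRationalResolution.Negative.PerfectClosureLevels
import Literature.AlgebraicGeometry.Resolution.AbsoluteIntegralClosureNoResolution
import HarnessLib

/-!
# `FRationalResolution` — negative lemma: `LocallyOfFiniteType` is load-bearing

Support (negative) lemma for crux stmt-ResolutionOfSingularities-15317
(`Summit.ResolutionOfSingularities.ResolutionOfSingularities.Theses.FrobeniusLadder.FRationalResolution`,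
route FrobeniusLadder, rank 4: "a reduced separated finite-type `X/k` admitting a proper birational model
`X' → X` all of whose stalks are domains in which every ideal generated by a system of parameters is
tightly closed — inline: `c ≠ 0 ∧ (∀ e, c·y^(p^e) ∈ span {z^(p^e) | z ∈ (s)}) ⇒ y ∈ (s)` — has a resolution
of singularities"), filed by the standing disprover (cdisprove cycle 1; work file
`Cruxes/FRationalResolution/Disproof.lean`). This file declares NO definition; the ring theory is in
`Negative/PerfectClosureLevels.lean`.

* `fRationalResolution_false_without_locallyOfFiniteType_at` / `…_without_locallyOfFiniteType` — the crux
  with the hypothesis `LocallyOfFiniteType f` dropped is FALSE at every prime `p`. Witness: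
  `X = X' = Spec R`, `π = 𝟙`, `R = PerfectClosure 𝔽_p[X] p = 𝔽_p[X^{1/p^∞}]` (the perfection of the affine
  line). `Spec R → Spec 𝔽_p` is affine (separated, quasi-compact) and reduced; `Spec R` has NO resolution
  (`Literature…not_hasResolution_spec_of_forall_exists_pow_eq`: every element of `R` is a `p`-th power and
  every `f ≠ 0` avoids a non-zero prime); yet EVERY stalk of `Spec R` satisfies the crux's F-rational
  clause (`clause_localizationAtPrime`, transported along `Spec.stalkIso` by the landed
  `ClauseInvariance.stub_clause_of_ringEquiv`): the localizations of `R` at primes are (non-Noetherian)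
  domains totally ordered by divisibility and archimedean (`Witness.total_at_prime`,
  `Witness.archimedean_at_prime`), and in any such domain every finitely generated ideal is tightly
  closed in the inline sense (`Core.mem_span_of_total_of_archimedean`).
* Reading for the provers: the typed clause does NOT by itself force Noetherian (let alone excellent)
  stalks — rank-one perfectoid-type local rings satisfy it — so every use of F-rationality in a proof of the
  crux must draw Noetherianity/excellence from `LocallyOfFiniteType f`; the clause's only content beyond
  tight closure of Noetherian rings is the Krull-intersection shape `⋂ₙ (tⁿ) ∌ c ≠ 0` for parameters `t`
  (`Cruxes/FRationalResolution/Disproof.lean`, `not_forall_mem_span_pow_of_clause`), which separates rank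
  one (admitted) from higher rank (excluded).

## Sources
* M. Artin, *On the joins of Hensel rings*, Adv. Math. 7 (1971) 282–296 (perfect rings are Noetherian only
  trivially) — as vendored in `Literature/AlgebraicGeometry/Resolution/AbsoluteIntegralClosureNoResolution.lean`.
* M. Hochster, C. Huneke, Trans. AMS 346 (1994), §4 (F-rational: parameter ideals tightly closed).
  Folklore.
-/

set_option linter.dupNamespace false

noncomputable section

open CategoryTheory AlgebraicGeometry
open Literature.AlgebraicGeometry.Resolution

/-! ## The clause at every localization of the witness ring, and the scheme-level assembly -/

namespace Summit.ResolutionOfSingularities.ResolutionOfSingularities.Theorems.FRationalResolution.Negative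

open Polynomial

/-- Every localization at a prime of the perfect closure of a PID of characteristic `p` satisfies the
crux's inline F-rational stalk clause (for the base `p`; in fact for every finite family of generators,
the dimension and radical provisos being unused). -/
theorem clause_localizationAtPrime (K : Type) [CommRing K] [IsDomain K] [IsPrincipalIdealRing K]
    (p : ℕ) [Fact p.Prime] [CharP K p] (Q : Ideal (PerfectClosure K p)) [Q.IsPrime] :
    IsDomain (Localization.AtPrime Q) ∧ ∀ d : ℕ, ringKrullDim (Localization.AtPrime Q) = d →
      ∀ s : Fin d → Localization.AtPrime Q, (Ideal.span (Set.range s)).radical.IsMaximal →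
      ∀ y c : Localization.AtPrime Q, c ≠ 0 →
      (∀ e : ℕ, c * y ^ p ^ e ∈ Ideal.span ((fun z : Localization.AtPrime Q => z ^ p ^ e) ''
        (Ideal.span (Set.range s) : Set (Localization.AtPrime Q)))) →
      y ∈ Ideal.span (Set.range s) := by
  haveI : IsDomain (PerfectClosure K p) := Witness.isDomain K p
  have hinj : Function.Injective (algebraMap (PerfectClosure K p) (Localization.AtPrime Q)) :=
    IsLocalization.injective (Localization.AtPrime Q) Q.primeCompl_le_nonZeroDivisors
  -- every element of the localization is associated to the image of a numerator
  have hassoc : ∀ l : Localization.AtPrime Q, ∃ a : PerfectClosure K p,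
      Associated (algebraMap (PerfectClosure K p) (Localization.AtPrime Q) a) l := by
    intro l
    obtain ⟨⟨a, u⟩, h⟩ := IsLocalization.surj Q.primeCompl l
    have hu : IsUnit (algebraMap (PerfectClosure K p) (Localization.AtPrime Q) u) :=
      IsLocalization.map_units (Localization.AtPrime Q) u
    refine ⟨a, hu.unit⁻¹, ?_⟩
    rw [← h, mul_assoc, IsUnit.mul_val_inv, mul_one]
  -- divisibility "at Q" in the ring gives divisibility of the images
  have hdvd : ∀ {a b u r : PerfectClosure K p}, u ∉ Q → b * u = a * r →
      algebraMap (PerfectClosure K p) (Localization.AtPrime Q) a ∣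
        algebraMap (PerfectClosure K p) (Localization.AtPrime Q) b := by
    intro a b u r hu hEq
    have hU : IsUnit (algebraMap (PerfectClosure K p) (Localization.AtPrime Q) u) :=
      IsLocalization.map_units (Localization.AtPrime Q) (⟨u, hu⟩ : Q.primeCompl)
    refine ⟨algebraMap (PerfectClosure K p) (Localization.AtPrime Q) r * ↑(hU.unit⁻¹), ?_⟩
    rw [← mul_assoc, ← map_mul, ← hEq, map_mul, mul_assoc, IsUnit.mul_val_inv, mul_one]
  -- total divisibility
  have hTD : ∀ a b : Localization.AtPrime Q, a ∣ b ∨ b ∣ a := by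
    intro l₁ l₂
    obtain ⟨a, ha⟩ := hassoc l₁
    obtain ⟨b, hb⟩ := hassoc l₂
    rcases Witness.total_at_prime K p Q a b with ⟨u, hu, r, hEq⟩ | ⟨u, hu, r, hEq⟩
    · exact Or.inl (ha.dvd_iff_dvd_left.mp (hb.dvd_iff_dvd_right.mp (hdvd hu hEq)))
    · exact Or.inr (hb.dvd_iff_dvd_left.mp (ha.dvd_iff_dvd_right.mp (hdvd hu hEq)))
  -- archimedean property
  have hAR : ∀ t c : Localization.AtPrime Q, t ≠ 0 → ¬ IsUnit t → c ≠ 0 →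
      ∃ n : ℕ, ¬ t ^ n ∣ c := by
    intro t c ht htu hc
    obtain ⟨t₁, ht₁⟩ := hassoc t
    obtain ⟨c₁, hc₁⟩ := hassoc c
    have ht₁0 : t₁ ≠ 0 := by
      rintro rfl
      rw [map_zero] at ht₁
      exact ht ((associated_zero_iff_eq_zero t).mp ht₁.symm)
    have hc₁0 : c₁ ≠ 0 := by
      rintro rfl
      rw [map_zero] at hc₁
      exact hc ((associated_zero_iff_eq_zero c).mp hc₁.symm)
    have ht₁Q : t₁ ∈ Q := by
      by_contra hnot
      exact htu (ht₁.isUnit (IsLocalization.map_units (Localization.AtPrime Q)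
        (⟨t₁, hnot⟩ : Q.primeCompl)))
    obtain ⟨N, hN⟩ := Witness.archimedean_at_prime K p Q t₁ c₁ ht₁Q ht₁0 hc₁0
    refine ⟨N, fun hdv => ?_⟩
    have h1 : algebraMap (PerfectClosure K p) (Localization.AtPrime Q) t₁ ^ N ∣
        algebraMap (PerfectClosure K p) (Localization.AtPrime Q) c₁ :=
      hc₁.dvd_iff_dvd_right.mpr (ht₁.pow_pow.dvd_iff_dvd_left.mpr hdv)
    obtain ⟨l, hl⟩ := h1
    obtain ⟨⟨d, v⟩, hv⟩ := IsLocalization.surj Q.primeCompl l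
    have : c₁ * v = t₁ ^ N * d := hinj (by
      rw [map_mul, map_mul, map_pow, hl, mul_assoc, hv])
    exact hN v v.2 d this
  refine ⟨inferInstance, fun d _ s _ y c hc h => ?_⟩
  exact Core.mem_span_of_total_of_archimedean (Fact.out : p.Prime).two_le hTD hAR s y c hc h

/-- **`FRationalResolution` without `LocallyOfFiniteType` is FALSE at every prime `p`.** The crux's
statement at `p` with the finite-type hypothesis dropped (all other hypotheses, the proper birational
F-rational locally-integral model included, kept verbatim) fails at `X = Spec (PerfectClosure 𝔽_p[X] p)`
with the model `𝟙 X`. Negative knowledge for stmt-ResolutionOfSingularities-15317: the finite-type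
hypothesis is load-bearing, and the F-rational clause alone does not make stalks Noetherian. [folklore] -/
theorem fRationalResolution_false_without_locallyOfFiniteType_at (p : ℕ) [hp : Fact p.Prime] :
    ¬ ∀ (k : Type) [Field k] [CharP k p] (X : Scheme.{0}) (f : X ⟶ Spec (.of k)),
      IsSeparated f → QuasiCompact f → IsReduced X →
      (∃ (X' : Scheme.{0}) (π : X' ⟶ X), IsProper π ∧ IsBirational π ∧
        ∀ x : X', IsDomain (X'.presheaf.stalk x) ∧ ∀ d : ℕ, ringKrullDim (X'.presheaf.stalk x) = d →
          ∀ s : Fin d → X'.presheaf.stalk x, (Ideal.span (Set.range s)).radical.IsMaximal →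
          ∀ y c : X'.presheaf.stalk x, c ≠ 0 →
          (∀ e : ℕ, c * y ^ p ^ e ∈ Ideal.span ((fun z : X'.presheaf.stalk x => z ^ p ^ e) ''
            (Ideal.span (Set.range s) : Set (X'.presheaf.stalk x)))) →
          y ∈ Ideal.span (Set.range s)) →
      Scheme.HasResolution X := by
  intro h
  haveI : IsDomain (PerfectClosure (ZMod p)[X] p) := Witness.isDomain (ZMod p)[X] p
  let f : Spec (.of (PerfectClosure (ZMod p)[X] p)) ⟶ Spec (.of (ZMod p)) :=
    Spec.map (CommRingCat.ofHom ((PerfectClosure.of (ZMod p)[X] p).comp Polynomial.C))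
  refine not_hasResolution_spec_of_forall_exists_pow_eq (PerfectClosure (ZMod p)[X] p)
    hp.out.two_le (Witness.exists_pow_eq (ZMod p)[X] p) (Witness.exists_prime_not_mem p) ?_
  refine h (ZMod p) _ f inferInstance inferInstance inferInstance
    ⟨Spec (.of (PerfectClosure (ZMod p)[X] p)), 𝟙 _, inferInstance, ⟨⊤, ?_, ?_, ?_⟩, fun x => ?_⟩
  · simp
  · simp
  · infer_instance
  · exact ClauseInvariance.stub_clause_of_ringEquiv p
      (Spec.stalkIso (.of (PerfectClosure (ZMod p)[X] p)) x).commRingCatIsoToRingEquiv.symm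
      (clause_localizationAtPrime (ZMod p)[X] p x.asIdeal)

/-- **`FRationalResolution` without `LocallyOfFiniteType` is FALSE** (the crux's own quantifier shape:
some prime — in fact every prime — carries a counterexample). -/
theorem fRationalResolution_false_without_locallyOfFiniteType :
    ¬ ∀ p : ℕ, p.Prime → ∀ (k : Type) [Field k] [CharP k p] (X : Scheme.{0}) (f : X ⟶ Spec (.of k)),
      IsSeparated f → QuasiCompact f → IsReduced X →
      (∃ (X' : Scheme.{0}) (π : X' ⟶ X), IsProper π ∧ IsBirational π ∧
        ∀ x : X', IsDomain (X'.presheaf.stalk x) ∧ ∀ d : ℕ, ringKrullDim (X'.presheaf.stalk x) = d →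
          ∀ s : Fin d → X'.presheaf.stalk x, (Ideal.span (Set.range s)).radical.IsMaximal →
          ∀ y c : X'.presheaf.stalk x, c ≠ 0 →
          (∀ e : ℕ, c * y ^ p ^ e ∈ Ideal.span ((fun z : X'.presheaf.stalk x => z ^ p ^ e) ''
            (Ideal.span (Set.range s) : Set (X'.presheaf.stalk x)))) →
          y ∈ Ideal.span (Set.range s)) →
      Scheme.HasResolution X :=
  fun h => (fRationalResolution_false_without_locallyOfFiniteType_at 2 (hp := ⟨Nat.prime_two⟩))
    (h 2 Nat.prime_two)

end Summit.ResolutionOfSingularities.ResolutionOfSingularities.Theorems.FRationalResolution.Negative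

end
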